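import Literature.Geometry.Lorentzian.CoreSobolev
import HarnessLib

/-!
# The Sobolev inequality on an asymptotically flat 3-manifold (Schoen–Yau 1979, Lemma 3.1)

Schoen–Yau, Comm. Math. Phys. 65 (1979), **Lemma 3.1** (p. 63): *"For any smooth function `ζ`
with compact support on `N`, `(∫_N |ζ|⁶)^{1/3} ≤ c₁ ∫_N |∇ζ|²`, where `c₁` depends only on `N`
and the metric `ds²`."* Here `N` is an oriented three dimensional asymptotically flat manifold
and the lemma is used for functions of class `C¹`. This file proves it (`AFEnd.sobolev_six_two`)
for a connected `3`-manifold `X` carrying data `(h, k)` with a sole end `e` on which the metric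
is asymptotically flat, `h − δ = O₂(r^{−α})` (`α > 0`), by the argument printed there: a cut-off
splits `ζ = ζ₁ + f` into a part `ζ₁ = (1 − χ_s ∘ coord) ζ` living on the end `N_k`, where the
Euclidean inequality applies (`EndSobolev.lean`), and a part `f = (χ_s ∘ coord) ζ` living on a
fixed compact region, where "the inequality follows from a standard partition of unity argument
together with the Poincaré inequality" (`CoreSobolev.lean`); the cut-off error `∫ ζ² |dχ_s|²`
is controlled by Hardy's inequality on the end (`sq_integral_annulus_le`). Auxiliary results:
`setIntegral_norm_fderiv_endValue_sq_le` (`∫_{‖y‖>s} ‖D(ζ∘Φ)‖² dy ≤ 2 ∫ h⁻¹(dζ,dζ) dV`),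
`setIntegral_sq_shell_le` (`∫_{s ≤ r ≤ 2s} ζ² dV ≤ 224 s² ∫ h⁻¹(dζ,dζ) dV`), the algebra of the
inverse metric on covectors (`innerDual_add_self_le`), and the energy of a product
(`lintegral_innerDual_cutoff_mul_le`). All results are proved; no named facts are introduced.

## References

* R. Schoen, S.-T. Yau, *On the proof of the positive mass conjecture in general relativity*,
  Comm. Math. Phys. 65 (1979) 45–76, Lemma 3.1 (p. 63).
-/

noncomputable section

open Set Function Filter Metric MeasureTheory Measure TopologicalSpace Bornology Manifold Bundle Module
open scoped Topology Manifold ContDiff ENNReal NNReal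

namespace Literature.Geometry.Lorentzian

open Literature.Analysis.FluidPDE Literature.Analysis.Calculus

/-! ### Algebra of the inverse metric on covectors -/

section InnerDualAlgebra

variable {X : Type} [TopologicalSpace X] [ChartedSpace E3 X] [IsManifold (𝓡 3) ∞ X]
  (h : ContMDiffRiemannianMetric (𝓡 3) ∞ E3 (TangentSpace (𝓡 3) : X → Type _))

/-- Bilinearity of the inverse metric: `h⁻¹(a α, b β) = a b h⁻¹(α, β)`. [folklore] -/
theorem innerDual_smul_smul (x : X) (a b : ℝ) (α β : Module.Dual ℝ (TangentSpace (𝓡 3) x)) :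
    (PseudoRiemannianMetric.ofRiemannian h).innerDual x (a • α) (b • β) =
      a * b * (PseudoRiemannianMetric.ofRiemannian h).innerDual x α β := by
  simp only [PseudoRiemannianMetric.innerDual, map_smul, LinearMap.smul_apply, smul_eq_mul]
  ring

/-- Symmetry of the inverse metric: `h⁻¹(α, β) = h⁻¹(β, α)`. [folklore] -/
theorem innerDual_comm (x : X) (α β : Module.Dual ℝ (TangentSpace (𝓡 3) x)) :
    (PseudoRiemannianMetric.ofRiemannian h).innerDual x α β =
      (PseudoRiemannianMetric.ofRiemannian h).innerDual x β α := by
  rw [PseudoRiemannianMetric.innerDual_eq_val_sharp_sharp,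
    PseudoRiemannianMetric.innerDual_eq_val_sharp_sharp, (PseudoRiemannianMetric.ofRiemannian h).symm]

/-- Additivity of the inverse metric in each slot. [folklore] -/
theorem innerDual_add_add (x : X) (α β γ δ : Module.Dual ℝ (TangentSpace (𝓡 3) x)) :
    (PseudoRiemannianMetric.ofRiemannian h).innerDual x (α + β) (γ + δ) =
      (PseudoRiemannianMetric.ofRiemannian h).innerDual x α γ +
      (PseudoRiemannianMetric.ofRiemannian h).innerDual x α δ +
      (PseudoRiemannianMetric.ofRiemannian h).innerDual x β γ +
      (PseudoRiemannianMetric.ofRiemannian h).innerDual x β δ := by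
  simp only [PseudoRiemannianMetric.innerDual, map_add, LinearMap.add_apply]
  ring

/-- **`h⁻¹(α + β, α + β) ≤ 2 h⁻¹(α, α) + 2 h⁻¹(β, β)`** for the (positive semidefinite) inverse of
a Riemannian metric (from `0 ≤ h⁻¹(α − β, α − β)`). [folklore] -/
theorem innerDual_add_self_le (x : X) (α β : Module.Dual ℝ (TangentSpace (𝓡 3) x)) :
    (PseudoRiemannianMetric.ofRiemannian h).innerDual x (α + β) (α + β) ≤
      2 * (PseudoRiemannianMetric.ofRiemannian h).innerDual x α α +
      2 * (PseudoRiemannianMetric.ofRiemannian h).innerDual x β β := by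
  have h1 := innerDual_add_add h x α β α β
  have h2 := innerDual_add_add h x α ((-1 : ℝ) • β) α ((-1 : ℝ) • β)
  have h3 := innerDual_self_nonneg h x (α + (-1 : ℝ) • β)
  rw [h2] at h3
  have e1 : (PseudoRiemannianMetric.ofRiemannian h).innerDual x α ((-1 : ℝ) • β) =
      -(PseudoRiemannianMetric.ofRiemannian h).innerDual x α β := by
    have := innerDual_smul_smul h x 1 (-1) α β
    rw [one_smul] at this
    rw [this]
    ring
  have e2 : (PseudoRiemannianMetric.ofRiemannian h).innerDual x ((-1 : ℝ) • β) α =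
      -(PseudoRiemannianMetric.ofRiemannian h).innerDual x α β := by
    rw [innerDual_comm h x _ α]
    exact e1
  have e3 : (PseudoRiemannianMetric.ofRiemannian h).innerDual x ((-1 : ℝ) • β) ((-1 : ℝ) • β) =
      (PseudoRiemannianMetric.ofRiemannian h).innerDual x β β := by
    rw [innerDual_smul_smul]
    ring
  rw [e1, e2, e3] at h3
  have e4 := innerDual_comm h x β α
  rw [h1]
  linarith

end InnerDualAlgebra

namespace AFEnd

variable {X : Type} [TopologicalSpace X] [ChartedSpace E3 X] (e : AFEnd X)

/-! ### The cut-off on the manifold: locality of its differential -/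

/-- A function which is eventually constant at `x` has `mvfderiv = 0` there. [folklore] -/
theorem mvfderiv_eq_zero_of_eventuallyEq_const [IsManifold (𝓡 3) ∞ X] {f : X → ℝ} {x : X} {c : ℝ}
    (hf : f =ᶠ[𝓝 x] fun _ ↦ c) : mvfderiv (𝓡 3) f x = 0 := by
  have h0 : mfderiv (𝓡 3) 𝓘(ℝ, ℝ) f x = 0 := by
    rw [hf.mfderiv_eq]
    exact mfderiv_const
  ext v
  simp [mvfderiv, h0]

/-- Off the end, `coord` is the junk value `0`. [folklore] -/
private theorem coord_of_not_mem₄ {q : X} (hq : q ∉ e.U) : e.coord q = 0 := by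
  classical
  exact dif_neg hq

/-- The closed far piece `{q ∈ U | s ≤ ‖coord q‖}` through `coord`. [folklore] -/
private theorem mem_closedFar_iff₄ {s : ℝ} {q : X} :
    q ∈ ((↑) : e.U → X) '' (e.chart ⁻¹' {x | s ≤ ‖(x : E3)‖}) ↔ ∃ _ : q ∈ e.U, s ≤ ‖e.coord q‖ := by
  constructor
  · rintro ⟨u, hu, rfl⟩
    refine ⟨u.2, ?_⟩
    rw [e.coord_of_mem u.2]
    simpa using hu
  · rintro ⟨hq, hR⟩
    refine ⟨⟨q, hq⟩, ?_, rfl⟩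
    rw [e.coord_of_mem hq] at hR
    simpa using hR

/-- **The differential of `χ_s ∘ coord` vanishes off the closed shell `{s ≤ ‖coord‖} ∖ far(2s)`**
(`s > R`): outside it the cut-off is locally constant (`= 1` off the closed far piece
`{s ≤ ‖coord‖}`, `= 0` on the open far region `far(2s)`). [folklore] -/
theorem mvfderiv_cutoff_coord_eq_zero [IsManifold (𝓡 3) ∞ X] {s : ℝ} (hs : e.R < s) {q : X}
    (hq : q ∉ ((↑) : e.U → X) '' (e.chart ⁻¹' {x | s ≤ ‖(x : E3)‖}) \ e.far (2 * s)) :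
    mvfderiv (𝓡 3) (fun p ↦ cutoff s (e.coord p)) q = 0 := by
  have hs0 : 0 < s := e.R_pos.trans hs
  rw [Set.mem_sdiff, not_and_or, not_not] at hq
  rcases hq with hq | hq
  · -- off the closed far piece: locally `= 1`
    refine mvfderiv_eq_zero_of_eventuallyEq_const (c := 1) ?_
    refine Filter.eventuallyEq_of_mem ((e.isClosed_far s hs).isOpen_compl.mem_nhds hq)
      fun p hp ↦ cutoff_eq_one hs0 ?_
    rw [mem_compl_iff, e.mem_closedFar_iff₄, not_exists] at hp
    by_cases hpU : p ∈ e.U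
    · exact le_of_lt (not_le.1 (hp hpU))
    · rw [e.coord_of_not_mem₄ hpU, norm_zero]
      exact hs0.le
  · -- on the far region `far(2s)`: locally `= 0`
    refine mvfderiv_eq_zero_of_eventuallyEq_const (c := 0) ?_
    refine Filter.eventuallyEq_of_mem ((e.isOpen_far (2 * s)).mem_nhds hq) fun p hp ↦ ?_
    obtain ⟨-, hp2⟩ := e.mem_far_iff_coord.1 hp
    exact cutoff_eq_zero hs0 hp2.le

/-- The closed shell `{s ≤ ‖coord‖} ∖ far(2s)` is compact for a sole end. [folklore] -/
theorem isCompact_closedShell [IsManifold (𝓡 3) ∞ X] {e : AFEnd X} (hsole : e.IsSoleEnd) {s : ℝ}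
    (hs : e.R < s) :
    IsCompact (((↑) : e.U → X) '' (e.chart ⁻¹' {x | s ≤ ‖(x : E3)‖}) \ e.far (2 * s)) := by
  exact (isCompact_compl_far hsole (2 * s)).of_isClosed_subset
    ((e.isClosed_far s hs).sdiff (e.isOpen_far _)) fun q hq ↦ hq.2

/-- Membership in the closed shell through `coord`. [folklore] -/
theorem mem_closedShell_iff {s : ℝ} {q : X} :
    q ∈ ((↑) : e.U → X) '' (e.chart ⁻¹' {x | s ≤ ‖(x : E3)‖}) \ e.far (2 * s) ↔
      ∃ _ : q ∈ e.U, s ≤ ‖e.coord q‖ ∧ ‖e.coord q‖ ≤ 2 * s := by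
  rw [Set.mem_sdiff, e.mem_closedFar_iff₄, e.mem_far_iff_coord]
  constructor
  · rintro ⟨⟨hqU, h1⟩, h2⟩
    refine ⟨hqU, h1, ?_⟩
    by_contra hlt
    exact h2 ⟨hqU, not_le.1 hlt⟩
  · rintro ⟨hqU, h1, h2⟩
    exact ⟨⟨hqU, h1⟩, fun ⟨_, h3⟩ ↦ absurd h3 (not_lt.2 h2)⟩

/-! ### Estimates on the end for compactly supported functions -/

variable [IsManifold (𝓡 3) ∞ X] [T2Space X] [LocallyCompactSpace X] [MeasurableSpace X] [BorelSpace X]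
  (D : InitialDataSet (𝓡 3) X) [D.metric.HasLeviCivita]

/-- **`∫_{‖y‖ > s} ‖D(ζ ∘ Φ)‖² dy ≤ 2 ∫_X h⁻¹(dζ, dζ) dV`** for `ζ ∈ C¹_c(X)`, when beyond radius
`s > R` the inverse metric times the density is `1/6`-close to `δ` (the pointwise bound
`norm_fderiv_endValue_sq_le` integrated through the chart formula `setLIntegral_far`).
[cite: SchoenYauPMT1979, proof of Lemma 3.1 (p. 63)] -/
theorem setIntegral_norm_fderiv_endValue_sq_le {s : ℝ} (hRs : e.R < s)
    (hW : ∀ z : E3, s ≤ ‖z‖ → ∀ k l,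
      |(Matrix.of fun i j ↦ hCoeff e D z (EuclideanSpace.single i 1)
          (EuclideanSpace.single j 1) : Matrix (Fin 3) (Fin 3) ℝ)⁻¹ k l *
        Real.sqrt (Matrix.of fun i j ↦ hCoeff e D z (EuclideanSpace.single i 1)
          (EuclideanSpace.single j 1) : Matrix (Fin 3) (Fin 3) ℝ).det -
        (1 : Matrix (Fin 3) (Fin 3) ℝ) k l| ≤ 1 / 6)
    {ζ : X → ℝ} (hζ1 : ContMDiff (𝓡 3) 𝓘(ℝ, ℝ) 1 ζ) (hζc : HasCompactSupport ζ) :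
    ∫ y in {y : E3 | s < ‖y‖}, ‖fderiv ℝ (endValue e ζ) y‖ ^ 2 ≤
      2 * ∫ x, D.metric.innerDual x (mvfderiv (𝓡 3) ζ x).toLinearMap
        (mvfderiv (𝓡 3) ζ x).toLinearMap ∂riemannianMeasure D.h := by
  classical
  haveI : (PseudoRiemannianMetric.ofRiemannian D.h).HasLeviCivita := ‹D.metric.HasLeviCivita›
  set μ : Measure X := riemannianMeasure D.h with hμ
  haveI : IsFiniteMeasureOnCompacts μ :=
    ⟨fun K hK ↦ riemannianVolume_lt_top_of_isCompact_holds D.h le_rfl hK⟩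
  set H : E3 → Matrix (Fin 3) (Fin 3) ℝ := fun z ↦ Matrix.of fun i j ↦
    hCoeff e D z (EuclideanSpace.single i 1) (EuclideanSpace.single j 1) with hHdef
  have hs0 : 0 < s := e.R_pos.trans hRs
  set u : E3 → ℝ := endValue e ζ with hu
  set ID : X → ℝ := fun x ↦ D.metric.innerDual x (mvfderiv (𝓡 3) ζ x).toLinearMap
    (mvfderiv (𝓡 3) ζ x).toLinearMap with hID
  set S : Set E3 := {y | s < ‖y‖} with hS
  have hSo : IsOpen S := isOpen_lt continuous_const continuous_norm
  have hSm : MeasurableSet S := hSo.measurableSet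
  have hu1 : ContDiffOn ℝ 1 u {y | e.R < ‖y‖} := e.contDiffOn_endValue_of_contMDiff (n := 1) hζ1
  obtain ⟨ρ, hρ⟩ := e.exists_radius_endValue_eq_zero hζc
  -- integrability of `‖Du‖²` on `S`
  have hDuzero : ∀ y : E3, ρ < ‖y‖ → fderiv ℝ u y = 0 := by
    intro y hy
    have hev : u =ᶠ[𝓝 y] fun _ ↦ 0 := by
      filter_upwards [(isOpen_lt continuous_const continuous_norm).mem_nhds hy] with z hz
      exact hρ z hz.le
    rw [hev.fderiv_eq, fderiv_const_apply]
  have hKc : IsCompact {y : E3 | s ≤ ‖y‖ ∧ ‖y‖ ≤ max s ρ} := by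
    have : {y : E3 | s ≤ ‖y‖ ∧ ‖y‖ ≤ max s ρ} = closedBall (0 : E3) (max s ρ) ∩ {y | s ≤ ‖y‖} := by
      ext y
      simp only [mem_setOf_eq, mem_inter_iff, mem_closedBall_zero_iff]
      tauto
    rw [this]
    exact (isCompact_closedBall _ _).inter_right (isClosed_le continuous_const continuous_norm)
  have hKsub : {y : E3 | s ≤ ‖y‖ ∧ ‖y‖ ≤ max s ρ} ⊆ {y | e.R < ‖y‖} := fun y hy ↦
    hRs.trans_le hy.1
  have hDuSint : Integrable (fun y ↦ ‖fderiv ℝ u y‖ ^ 2) (volume.restrict S) := by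
    have h1 : IntegrableOn (fun y ↦ ‖fderiv ℝ u y‖ ^ 2) {y : E3 | s ≤ ‖y‖ ∧ ‖y‖ ≤ max s ρ}
        volume :=
      (((hu1.continuousOn_fderiv_of_isOpen (isOpen_lt continuous_const continuous_norm)
        le_rfl).norm.pow 2).mono hKsub).integrableOn_compact hKc
    have hs' : S ⊆ {y : E3 | s ≤ ‖y‖ ∧ ‖y‖ ≤ max s ρ} ∪ {y : E3 | max s ρ < ‖y‖} := by
      intro y hy
      by_cases h : ‖y‖ ≤ max s ρ
      · exact Or.inl ⟨le_of_lt hy, h⟩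
      · exact Or.inr (not_le.1 h)
    refine IntegrableOn.mono_set (h1.union ?_) hs'
    refine (integrableOn_zero).congr_fun (fun y hy ↦ ?_)
      (isOpen_lt continuous_const continuous_norm).measurableSet
    have hyρ : ρ < ‖y‖ := (le_max_right _ _).trans_lt hy
    simp [hDuzero y hyρ]
  set J : ℝ := ∫ y in S, ‖fderiv ℝ u y‖ ^ 2 with hJ
  -- the Dirichlet integrand
  have hIDc : Continuous ID := continuous_innerDual_mvfderiv D.metric hζ1 hζ1
  have hID0 : ∀ x, 0 ≤ ID x := fun x ↦ innerDual_self_nonneg D.h x _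
  have hIDcs : HasCompactSupport ID := by
    refine HasCompactSupport.intro hζc fun x hx ↦ ?_
    have hev : ζ =ᶠ[𝓝 x] fun _ ↦ 0 := notMem_tsupport_iff_eventuallyEq.1 hx
    simp only [hID, PseudoRiemannianMetric.mvfderiv_eq_zero_of_eventuallyEq_zero hev,
      ContinuousLinearMap.toLinearMap_zero, PseudoRiemannianMetric.innerDual, LinearMap.zero_apply]
  have hIDi : Integrable ID μ := hIDc.integrable_of_hasCompactSupport hIDcs
  -- pointwise in the chart
  have hpt : ∀ z ∈ S, ‖fderiv ℝ u z‖ ^ 2 ≤ 2 * ID (e.dataChartExt z) * Real.sqrt (H z).det := by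
    intro z hz
    have hzR : e.R < ‖z‖ := hRs.trans hz
    have hmd : MDifferentiableAt (𝓡 3) 𝓘(ℝ, ℝ) ζ (e.dataChart ⟨z, hzR⟩) :=
      hζ1.mdifferentiableAt one_ne_zero
    have h := e.norm_fderiv_endValue_sq_le D ⟨z, hzR⟩ hmd (hW z (le_of_lt hz))
    rw [e.dataChartExt_of_lt hzR, mul_assoc]
    exact h
  have h1 : ENNReal.ofReal J = ∫⁻ z in S, ENNReal.ofReal (‖fderiv ℝ u z‖ ^ 2) :=
    ofReal_integral_eq_lintegral_ofReal hDuSint (Eventually.of_forall fun _ ↦ by positivity)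
  have h2 : ∫⁻ z in S, ENNReal.ofReal (‖fderiv ℝ u z‖ ^ 2) ≤
      ∫⁻ z in S, ENNReal.ofReal (2 * ID (e.dataChartExt z)) * ENNReal.ofReal (Real.sqrt (H z).det) := by
    refine setLIntegral_mono' hSm fun z hz ↦ ?_
    rw [← ENNReal.ofReal_mul (show (0 : ℝ) ≤ 2 * ID (e.dataChartExt z) by
      linarith [hID0 (e.dataChartExt z)])]
    exact ENNReal.ofReal_le_ofReal (hpt z hz)
  have h3 : ∫⁻ z in S, ENNReal.ofReal (2 * ID (e.dataChartExt z)) * ENNReal.ofReal (Real.sqrt (H z).det) =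
      ∫⁻ p in e.far s, ENNReal.ofReal (2 * ID p) ∂μ :=
    (e.setLIntegral_far D (fun p ↦ ENNReal.ofReal (2 * ID p)) hRs.le).symm
  have h4 : ∫⁻ p in e.far s, ENNReal.ofReal (2 * ID p) ∂μ ≤ ∫⁻ p, ENNReal.ofReal (2 * ID p) ∂μ :=
    setLIntegral_le_lintegral _ _
  have h5 : ∫⁻ p, ENNReal.ofReal (2 * ID p) ∂μ = ENNReal.ofReal (∫ p, 2 * ID p ∂μ) :=
    (ofReal_integral_eq_lintegral_ofReal (hIDi.const_mul 2)
      (Eventually.of_forall fun p ↦ show (0 : ℝ) ≤ 2 * ID p by linarith [hID0 p])).symm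
  have h6 : ENNReal.ofReal J ≤ ENNReal.ofReal (2 * ∫ x, ID x ∂μ) := by
    rw [h1, ← integral_const_mul, ← h5]
    exact h2.trans (h3.le.trans h4)
  have hI0 : 0 ≤ ∫ x, ID x ∂μ := integral_nonneg hID0
  exact (ENNReal.ofReal_le_ofReal_iff (by linarith)).1 h6

/-- **The shell is controlled by the gradient**: for `ζ ∈ C¹_c(X)` and a radius `s > R` beyond
which the density is `≤ 7` and the inverse metric times the density is `1/6`-close to `δ`,
`∫_{s ≤ ‖coord‖ ≤ 2s} ζ² dV ≤ 224 s² ∫_X h⁻¹(dζ, dζ) dV` — in the chart `dV ≤ 7 dz`, Hardy's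
inequality on the annulus (`sq_integral_annulus_le`: `∫_{s<‖y‖≤2s} u² ≤ 16 s² ∫_{‖y‖>s} ‖Du‖²`)
and `setIntegral_norm_fderiv_endValue_sq_le`. [cite: SchoenYauPMT1979, proof of Lemma 3.1 (p. 63)] -/
theorem setIntegral_sq_shell_le {s : ℝ} (hRs : e.R < s)
    (hW : ∀ z : E3, s ≤ ‖z‖ → ∀ k l,
      |(Matrix.of fun i j ↦ hCoeff e D z (EuclideanSpace.single i 1)
          (EuclideanSpace.single j 1) : Matrix (Fin 3) (Fin 3) ℝ)⁻¹ k l *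
        Real.sqrt (Matrix.of fun i j ↦ hCoeff e D z (EuclideanSpace.single i 1)
          (EuclideanSpace.single j 1) : Matrix (Fin 3) (Fin 3) ℝ).det -
        (1 : Matrix (Fin 3) (Fin 3) ℝ) k l| ≤ 1 / 6)
    (hdens : ∀ z : E3, s ≤ ‖z‖ → Real.sqrt (Matrix.of fun i j ↦
      hCoeff e D z (EuclideanSpace.single i 1) (EuclideanSpace.single j 1)).det ≤ 7)
    {ζ : X → ℝ} (hζ1 : ContMDiff (𝓡 3) 𝓘(ℝ, ℝ) 1 ζ) (hζc : HasCompactSupport ζ) :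
    ∫ x in ((↑) : e.U → X) '' (e.chart ⁻¹' {x | s ≤ ‖(x : E3)‖}) \ e.far (2 * s), ζ x ^ 2
        ∂riemannianMeasure D.h ≤
      224 * s ^ 2 * ∫ x, D.metric.innerDual x (mvfderiv (𝓡 3) ζ x).toLinearMap
        (mvfderiv (𝓡 3) ζ x).toLinearMap ∂riemannianMeasure D.h := by
  classical
  set μ : Measure X := riemannianMeasure D.h with hμ
  set A : Set X := ((↑) : e.U → X) '' (e.chart ⁻¹' {x | s ≤ ‖(x : E3)‖}) \ e.far (2 * s) with hA
  have hs0 : 0 < s := e.R_pos.trans hRs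
  set R' : ℝ := (e.R + s) / 2 with hR'
  have hRR' : e.R < R' := by rw [hR']; linarith
  have hR's : R' < s := by rw [hR']; linarith
  set u : E3 → ℝ := endValue e ζ with hu
  set ID : X → ℝ := fun x ↦ D.metric.innerDual x (mvfderiv (𝓡 3) ζ x).toLinearMap
    (mvfderiv (𝓡 3) ζ x).toLinearMap with hID
  set sh : Set E3 := {z | s ≤ ‖z‖ ∧ ‖z‖ ≤ 2 * s} with hsh
  set sh' : Set E3 := {z | s < ‖z‖ ∧ ‖z‖ ≤ 2 * s} with hsh'
  have hshm : MeasurableSet sh :=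
    (isClosed_le continuous_const continuous_norm).measurableSet.inter
      (isClosed_le continuous_norm continuous_const).measurableSet
  have hsh'm : MeasurableSet sh' :=
    (isOpen_lt continuous_const continuous_norm).measurableSet.inter
      (isClosed_le continuous_norm continuous_const).measurableSet
  have hAm : MeasurableSet A :=
    (e.isClosed_far s hRs).measurableSet.diff (e.isOpen_far _).measurableSet
  have hAfar : A ⊆ e.far R' := by
    intro q hq
    obtain ⟨hqU, h1, -⟩ := e.mem_closedShell_iff.1 hq
    exact e.mem_far_iff_coord.2 ⟨hqU, hR's.trans_le h1⟩
  -- (1) to the chart: `∫_A ζ² = ∫_{R' < ‖z‖} 1_A(Φ z) ζ(Φ z)² √det dz`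
  have h1 : ∫ x in A, ζ x ^ 2 ∂μ = ∫ x in e.far R', A.indicator (fun x ↦ ζ x ^ 2) x ∂μ := by
    rw [setIntegral_indicator hAm, inter_eq_right.2 hAfar]
  have h2 := e.setIntegral_far D (A.indicator fun x ↦ ζ x ^ 2) hRR'.le
  -- the integrand in the chart is `1_{sh} u²  √det`
  have hchart : ∀ z : E3, R' < ‖z‖ →
      A.indicator (fun x ↦ ζ x ^ 2) (e.dataChartExt z) = sh.indicator (fun z ↦ u z ^ 2) z := by
    intro z hz
    have hzR : e.R < ‖z‖ := hRR'.trans hz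
    rw [e.dataChartExt_of_lt hzR]
    have hqU : e.dataChart ⟨z, hzR⟩ ∈ e.U := (e.chart.symm ⟨z, hzR⟩).2
    have hcoord : e.coord (e.dataChart ⟨z, hzR⟩) = z := e.coord_dataChart ⟨z, hzR⟩
    by_cases hzsh : z ∈ sh
    · have hqA : e.dataChart ⟨z, hzR⟩ ∈ A :=
        e.mem_closedShell_iff.2 ⟨hqU, by rw [hcoord]; exact hzsh.1, by rw [hcoord]; exact hzsh.2⟩
      rw [indicator_of_mem hqA, indicator_of_mem hzsh, hu, endValue_of_lt e ζ hzR]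
    · have hqA : e.dataChart ⟨z, hzR⟩ ∉ A := by
        intro hqA
        obtain ⟨-, h1', h2'⟩ := e.mem_closedShell_iff.1 hqA
        rw [hcoord] at h1' h2'
        exact hzsh ⟨h1', h2'⟩
      rw [indicator_of_notMem hqA, indicator_of_notMem hzsh]
  have h3 : ∫ z in {z : E3 | R' < ‖z‖}, A.indicator (fun x ↦ ζ x ^ 2) (e.dataChartExt z) *
      Real.sqrt (Matrix.of fun i j ↦ hCoeff e D z (EuclideanSpace.single i 1)
        (EuclideanSpace.single j 1)).det =
      ∫ z in {z : E3 | R' < ‖z‖}, sh.indicator (fun z ↦ u z ^ 2) z *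
        Real.sqrt (Matrix.of fun i j ↦ hCoeff e D z (EuclideanSpace.single i 1)
          (EuclideanSpace.single j 1)).det :=
    setIntegral_congr_fun (isOpen_lt continuous_const continuous_norm).measurableSet
      fun z hz ↦ by rw [hchart z hz]
  -- (2) density `≤ 7` on the shell
  have hshc : IsCompact sh := by
    have : sh = closedBall (0 : E3) (2 * s) ∩ {z | s ≤ ‖z‖} := by
      ext z
      simp only [hsh, mem_setOf_eq, mem_inter_iff, mem_closedBall_zero_iff]
      tauto
    rw [this]
    exact (isCompact_closedBall _ _).inter_right (isClosed_le continuous_const continuous_norm)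
  have hu1 : ContDiffOn ℝ 1 u {y | e.R < ‖y‖} := e.contDiffOn_endValue_of_contMDiff (n := 1) hζ1
  have hush : IntegrableOn (fun z ↦ u z ^ 2) sh volume :=
    ((hu1.continuousOn.pow 2).mono fun z hz ↦ hRs.trans_le hz.1).integrableOn_compact hshc
  have hind : Integrable (sh.indicator fun z ↦ u z ^ 2) (volume : Measure E3) :=
    (integrable_indicator_iff hshm).2 hush
  have h4 : ∫ z in {z : E3 | R' < ‖z‖}, sh.indicator (fun z ↦ u z ^ 2) z *
        Real.sqrt (Matrix.of fun i j ↦ hCoeff e D z (EuclideanSpace.single i 1)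
          (EuclideanSpace.single j 1)).det ≤
      ∫ z in {z : E3 | R' < ‖z‖}, 7 * sh.indicator (fun z ↦ u z ^ 2) z := by
    refine integral_mono_of_nonneg ?_ ((hind.const_mul 7).integrableOn) ?_
    · refine Eventually.of_forall fun z ↦ mul_nonneg (indicator_nonneg (fun _ _ ↦ sq_nonneg _) _)
        (Real.sqrt_nonneg _)
    · refine Eventually.of_forall fun z ↦ ?_
      show sh.indicator (fun z ↦ u z ^ 2) z * _ ≤ 7 * sh.indicator (fun z ↦ u z ^ 2) z
      by_cases hz : z ∈ sh
      · rw [indicator_of_mem hz]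
        have h7 := hdens z hz.1
        have h0 : 0 ≤ u z ^ 2 := sq_nonneg _
        calc u z ^ 2 * Real.sqrt _ ≤ u z ^ 2 * 7 := mul_le_mul_of_nonneg_left h7 h0
          _ = 7 * u z ^ 2 := by ring
      · simp only [indicator_of_notMem hz, zero_mul, mul_zero, le_refl]
  have h5 : ∫ z in {z : E3 | R' < ‖z‖}, 7 * sh.indicator (fun z ↦ u z ^ 2) z =
      7 * ∫ z in sh, u z ^ 2 := by
    have hsub : sh ⊆ {z : E3 | R' < ‖z‖} := fun z hz ↦ hR's.trans_le hz.1
    rw [integral_const_mul, setIntegral_indicator hshm, inter_eq_right.2 hsub]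
  -- (3) the inner sphere is null: `∫_{sh} u² = ∫_{sh'} u²`
  have h6 : ∫ z in sh, u z ^ 2 = ∫ z in sh', u z ^ 2 := by
    refine setIntegral_congr_set ?_
    refine (ae_eq_set.2 ⟨?_, ?_⟩).symm
    · have : sh' \ sh = ∅ := Set.sdiff_eq_empty.2 fun z hz ↦ ⟨hz.1.le, hz.2⟩
      rw [this, measure_empty]
    · refine measure_mono_null (fun z hz ↦ ?_) (Measure.addHaar_sphere_of_ne_zero volume (0 : E3) hs0.ne')
      obtain ⟨⟨h1, h2⟩, h3⟩ := hz
      rw [mem_sphere_zero_iff_norm]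
      by_contra hne
      exact h3 ⟨lt_of_le_of_ne h1 (Ne.symm hne), h2⟩
  -- (4) Hardy on the annulus and the gradient bound
  obtain ⟨ρ, hρ⟩ := e.exists_radius_endValue_eq_zero hζc
  have hH := sq_integral_annulus_le (E := E3) finrank_euclideanSpace_fin e.R_pos hRs hu1 hρ
  have hG := e.setIntegral_norm_fderiv_endValue_sq_le D hRs hW hζ1 hζc
  -- (5) assemble
  calc ∫ x in A, ζ x ^ 2 ∂μ
      = ∫ z in {z : E3 | R' < ‖z‖}, sh.indicator (fun z ↦ u z ^ 2) z *
          Real.sqrt (Matrix.of fun i j ↦ hCoeff e D z (EuclideanSpace.single i 1)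
            (EuclideanSpace.single j 1)).det := by rw [h1, h2, h3]
    _ ≤ 7 * ∫ z in sh, u z ^ 2 := by rw [← h5]; exact h4
    _ = 7 * ∫ z in sh', u z ^ 2 := by rw [h6]
    _ ≤ 7 * (16 * s ^ 2 * ∫ y in {y : E3 | s < ‖y‖}, ‖fderiv ℝ u y‖ ^ 2) :=
        mul_le_mul_of_nonneg_left hH (by norm_num)
    _ ≤ 7 * (16 * s ^ 2 * (2 * ∫ x, ID x ∂μ)) := by gcongr
    _ = 224 * s ^ 2 * ∫ x, ID x ∂μ := by ring

/-! ### The energy of the truncation to the core -/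

/-- `(x + y)³ ≤ 4 (x³ + y³)` for `x, y ≥ 0`. [folklore] -/
private theorem add_pow_three_le {x y : ℝ} (hx : 0 ≤ x) (hy : 0 ≤ y) :
    (x + y) ^ 3 ≤ 4 * (x ^ 3 + y ^ 3) := by
  nlinarith [mul_nonneg (add_nonneg hx hy) (sq_nonneg (x - y))]

/-- `(a + b)⁶ ≤ 32 (a⁶ + b⁶)`. [folklore] -/
private theorem add_pow_six_le (a b : ℝ) : (a + b) ^ 6 ≤ 32 * (a ^ 6 + b ^ 6) := by
  have h1 : (a + b) ^ 2 ≤ 2 * a ^ 2 + 2 * b ^ 2 := by nlinarith [sq_nonneg (a - b)]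
  have h2 : (a + b) ^ 6 ≤ (2 * a ^ 2 + 2 * b ^ 2) ^ 3 := by
    rw [show (a + b) ^ 6 = ((a + b) ^ 2) ^ 3 by ring]
    exact pow_le_pow_left₀ (sq_nonneg _) h1 3
  have h3 := add_pow_three_le (sq_nonneg a) (sq_nonneg b)
  calc (a + b) ^ 6 ≤ (2 * a ^ 2 + 2 * b ^ 2) ^ 3 := h2
    _ = 8 * (a ^ 2 + b ^ 2) ^ 3 := by ring
    _ ≤ 8 * (4 * ((a ^ 2) ^ 3 + (b ^ 2) ^ 3)) := by linarith
    _ = 32 * (a ^ 6 + b ^ 6) := by ring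

/-- **The energy of the truncation to the core**: for a radius `s > R` as in
`setIntegral_sq_shell_le` on a sole end there is `C_χ` such that for every `ζ ∈ C¹_c(X)`, with
`f = (χ_s ∘ coord) ζ`, `∫_X h⁻¹(df, df) dV ≤ C_χ ∫_X h⁻¹(dζ, dζ) dV`: pointwise
`h⁻¹(df,df) ≤ 2 χ² h⁻¹(dζ,dζ) + 2 ζ² h⁻¹(dχ,dχ)` (`innerDual_add_self_le`, Leibniz rule
`mvfderiv_fun_mul`), `h⁻¹(dχ, dχ)` is bounded and vanishes off the compact shell
`{s ≤ ‖coord‖ ≤ 2s}` (`mvfderiv_cutoff_coord_eq_zero`), and the shell is controlled by the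
gradient (`setIntegral_sq_shell_le`). [cite: SchoenYauPMT1979, proof of Lemma 3.1 (p. 63)] -/
theorem exists_integral_innerDual_cutoff_mul_le (hsole : e.IsSoleEnd) {s : ℝ} (hRs : e.R < s)
    (hW : ∀ z : E3, s ≤ ‖z‖ → ∀ k l,
      |(Matrix.of fun i j ↦ hCoeff e D z (EuclideanSpace.single i 1)
          (EuclideanSpace.single j 1) : Matrix (Fin 3) (Fin 3) ℝ)⁻¹ k l *
        Real.sqrt (Matrix.of fun i j ↦ hCoeff e D z (EuclideanSpace.single i 1)
          (EuclideanSpace.single j 1) : Matrix (Fin 3) (Fin 3) ℝ).det -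
        (1 : Matrix (Fin 3) (Fin 3) ℝ) k l| ≤ 1 / 6)
    (hdens : ∀ z : E3, s ≤ ‖z‖ → Real.sqrt (Matrix.of fun i j ↦
      hCoeff e D z (EuclideanSpace.single i 1) (EuclideanSpace.single j 1)).det ≤ 7) :
    ∃ Cχ : ℝ, 0 ≤ Cχ ∧ ∀ ζ : X → ℝ, ContMDiff (𝓡 3) 𝓘(ℝ, ℝ) 1 ζ → HasCompactSupport ζ →
      Integrable (fun x ↦ D.metric.innerDual x
        (mvfderiv (𝓡 3) (fun q ↦ cutoff s (e.coord q) * ζ q) x).toLinearMap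
        (mvfderiv (𝓡 3) (fun q ↦ cutoff s (e.coord q) * ζ q) x).toLinearMap) (riemannianMeasure D.h) ∧
      ∫ x, D.metric.innerDual x
        (mvfderiv (𝓡 3) (fun q ↦ cutoff s (e.coord q) * ζ q) x).toLinearMap
        (mvfderiv (𝓡 3) (fun q ↦ cutoff s (e.coord q) * ζ q) x).toLinearMap ∂riemannianMeasure D.h ≤
      Cχ * ∫ x, D.metric.innerDual x (mvfderiv (𝓡 3) ζ x).toLinearMap
        (mvfderiv (𝓡 3) ζ x).toLinearMap ∂riemannianMeasure D.h := by
  classical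
  set μ : Measure X := riemannianMeasure D.h with hμ
  haveI : IsFiniteMeasureOnCompacts μ :=
    ⟨fun K hK ↦ riemannianVolume_lt_top_of_isCompact_holds D.h le_rfl hK⟩
  have hs0 : 0 < s := e.R_pos.trans hRs
  set χ : X → ℝ := fun q ↦ cutoff s (e.coord q) with hχ
  have hχs : ContMDiff (𝓡 3) 𝓘(ℝ, ℝ) ∞ χ := e.contMDiff_cutoff_coord hRs
  have hχ1 : ContMDiff (𝓡 3) 𝓘(ℝ, ℝ) 1 χ := hχs.of_le (by norm_num)
  have hχb : ∀ q, 0 ≤ χ q ∧ χ q ≤ 1 := fun q ↦ ⟨cutoff_nonneg s _, cutoff_le_one s _⟩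
  set A : Set X := ((↑) : e.U → X) '' (e.chart ⁻¹' {x | s ≤ ‖(x : E3)‖}) \ e.far (2 * s) with hA
  have hAc : IsCompact A := isCompact_closedShell hsole hRs
  have hAm : MeasurableSet A :=
    (e.isClosed_far s hRs).measurableSet.diff (e.isOpen_far _).measurableSet
  set Iχ : X → ℝ := fun q ↦ D.metric.innerDual q (mvfderiv (𝓡 3) χ q).toLinearMap
    (mvfderiv (𝓡 3) χ q).toLinearMap with hIχ
  have hIχc : Continuous Iχ := continuous_innerDual_mvfderiv D.metric hχ1 hχ1
  have hIχ0 : ∀ q, 0 ≤ Iχ q := fun q ↦ innerDual_self_nonneg D.h q _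
  have hIχA : ∀ q, q ∉ A → Iχ q = 0 := by
    intro q hq
    have h0 : mvfderiv (𝓡 3) χ q = 0 := by
      rw [hχ]
      exact e.mvfderiv_cutoff_coord_eq_zero hRs hq
    simp only [hIχ, h0, ContinuousLinearMap.toLinearMap_zero, PseudoRiemannianMetric.innerDual,
      LinearMap.zero_apply]
  obtain ⟨M₀, hM₀⟩ := hAc.exists_bound_of_continuousOn hIχc.continuousOn
  set M : ℝ := max M₀ 0 with hM
  have hM0 : 0 ≤ M := le_max_right _ _
  have hIχM : ∀ q, Iχ q ≤ M * A.indicator (fun _ ↦ (1 : ℝ)) q := by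
    intro q
    by_cases hq : q ∈ A
    · rw [indicator_of_mem hq, mul_one]
      have h := hM₀ q hq
      rw [Real.norm_eq_abs, abs_of_nonneg (hIχ0 q)] at h
      exact h.trans (le_max_left _ _)
    · rw [indicator_of_notMem hq, mul_zero, hIχA q hq]
  refine ⟨2 + 2 * M * (224 * s ^ 2), by positivity, fun ζ hζ1 hζc ↦ ?_⟩
  set f : X → ℝ := fun q ↦ χ q * ζ q with hf
  set ID : X → ℝ := fun x ↦ D.metric.innerDual x (mvfderiv (𝓡 3) ζ x).toLinearMap
    (mvfderiv (𝓡 3) ζ x).toLinearMap with hID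
  set IDf : X → ℝ := fun x ↦ D.metric.innerDual x (mvfderiv (𝓡 3) f x).toLinearMap
    (mvfderiv (𝓡 3) f x).toLinearMap with hIDf
  have hf1 : ContMDiff (𝓡 3) 𝓘(ℝ, ℝ) 1 f := hχ1.mul hζ1
  have hfc : HasCompactSupport f := hζc.mul_left
  -- integrability of the Dirichlet integrands
  have hIDc : Continuous ID := continuous_innerDual_mvfderiv D.metric hζ1 hζ1
  have hID0 : ∀ x, 0 ≤ ID x := fun x ↦ innerDual_self_nonneg D.h x _
  have hIDcs : HasCompactSupport ID := by
    refine HasCompactSupport.intro hζc fun x hx ↦ ?_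
    have hev : ζ =ᶠ[𝓝 x] fun _ ↦ 0 := notMem_tsupport_iff_eventuallyEq.1 hx
    simp only [hID, PseudoRiemannianMetric.mvfderiv_eq_zero_of_eventuallyEq_zero hev,
      ContinuousLinearMap.toLinearMap_zero, PseudoRiemannianMetric.innerDual, LinearMap.zero_apply]
  have hIDi : Integrable ID μ := hIDc.integrable_of_hasCompactSupport hIDcs
  have hIDfc : Continuous IDf := continuous_innerDual_mvfderiv D.metric hf1 hf1
  have hIDfcs : HasCompactSupport IDf := by
    refine HasCompactSupport.intro hfc fun x hx ↦ ?_
    have hev : f =ᶠ[𝓝 x] fun _ ↦ 0 := notMem_tsupport_iff_eventuallyEq.1 hx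
    simp only [hIDf, PseudoRiemannianMetric.mvfderiv_eq_zero_of_eventuallyEq_zero hev,
      ContinuousLinearMap.toLinearMap_zero, PseudoRiemannianMetric.innerDual, LinearMap.zero_apply]
  have hIDfi : Integrable IDf μ := hIDfc.integrable_of_hasCompactSupport hIDfcs
  refine ⟨hIDfi, ?_⟩
  -- the pointwise bound `h⁻¹(df, df) ≤ 2 ID + 2 M ζ² 1_A`
  have hpt : ∀ q, IDf q ≤ 2 * ID q + 2 * M * A.indicator (fun x ↦ ζ x ^ 2) q := by
    intro q
    have hχd : MDifferentiableAt (𝓡 3) 𝓘(ℝ, ℝ) χ q := hχ1.mdifferentiableAt one_ne_zero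
    have hζd : MDifferentiableAt (𝓡 3) 𝓘(ℝ, ℝ) ζ q := hζ1.mdifferentiableAt one_ne_zero
    have hprod : mvfderiv (𝓡 3) f q = χ q • mvfderiv (𝓡 3) ζ q + ζ q • mvfderiv (𝓡 3) χ q :=
      mvfderiv_fun_mul hχd hζd
    have hcoe : (mvfderiv (𝓡 3) f q).toLinearMap =
        χ q • (mvfderiv (𝓡 3) ζ q).toLinearMap + ζ q • (mvfderiv (𝓡 3) χ q).toLinearMap := by
      rw [hprod, ContinuousLinearMap.toLinearMap_add, ContinuousLinearMap.toLinearMap_smul,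
        ContinuousLinearMap.toLinearMap_smul]
    have h1 := innerDual_add_self_le D.h q (χ q • (mvfderiv (𝓡 3) ζ q).toLinearMap)
      (ζ q • (mvfderiv (𝓡 3) χ q).toLinearMap)
    have h2 := innerDual_smul_smul D.h q (χ q) (χ q) (mvfderiv (𝓡 3) ζ q).toLinearMap
      (mvfderiv (𝓡 3) ζ q).toLinearMap
    have h3 := innerDual_smul_smul D.h q (ζ q) (ζ q) (mvfderiv (𝓡 3) χ q).toLinearMap
      (mvfderiv (𝓡 3) χ q).toLinearMap
    have hIDfq : IDf q = D.metric.innerDual q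
        (χ q • (mvfderiv (𝓡 3) ζ q).toLinearMap + ζ q • (mvfderiv (𝓡 3) χ q).toLinearMap)
        (χ q • (mvfderiv (𝓡 3) ζ q).toLinearMap + ζ q • (mvfderiv (𝓡 3) χ q).toLinearMap) := by
      simp only [hIDf, hcoe]
    have hχq := hχb q
    have hχsq : χ q * χ q ≤ 1 := by nlinarith
    have hIq := hIχM q
    change IDf q ≤ 2 * ID q + 2 * M * A.indicator (fun x ↦ ζ x ^ 2) q
    rw [hIDfq]
    change D.metric.innerDual q _ _ ≤ 2 * (PseudoRiemannianMetric.ofRiemannian D.h).innerDual q _ _ +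
      2 * (PseudoRiemannianMetric.ofRiemannian D.h).innerDual q _ _ at h1
    rw [h2, h3] at h1
    have hI0 := hID0 q
    have hIχ0q := hIχ0 q
    change 0 ≤ (PseudoRiemannianMetric.ofRiemannian D.h).innerDual q _ _ at hI0
    change 0 ≤ (PseudoRiemannianMetric.ofRiemannian D.h).innerDual q _ _ at hIχ0q
    change (PseudoRiemannianMetric.ofRiemannian D.h).innerDual q _ _ ≤ M * _ at hIq
    calc D.metric.innerDual q
          (χ q • (mvfderiv (𝓡 3) ζ q).toLinearMap + ζ q • (mvfderiv (𝓡 3) χ q).toLinearMap)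
          (χ q • (mvfderiv (𝓡 3) ζ q).toLinearMap + ζ q • (mvfderiv (𝓡 3) χ q).toLinearMap)
        ≤ 2 * (χ q * χ q * (PseudoRiemannianMetric.ofRiemannian D.h).innerDual q
            (mvfderiv (𝓡 3) ζ q).toLinearMap (mvfderiv (𝓡 3) ζ q).toLinearMap) +
          2 * (ζ q * ζ q * (PseudoRiemannianMetric.ofRiemannian D.h).innerDual q
            (mvfderiv (𝓡 3) χ q).toLinearMap (mvfderiv (𝓡 3) χ q).toLinearMap) := h1
      _ ≤ 2 * (PseudoRiemannianMetric.ofRiemannian D.h).innerDual q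
            (mvfderiv (𝓡 3) ζ q).toLinearMap (mvfderiv (𝓡 3) ζ q).toLinearMap +
          2 * (ζ q * ζ q * (M * A.indicator (fun _ ↦ (1 : ℝ)) q)) := by
          have ha : χ q * χ q * (PseudoRiemannianMetric.ofRiemannian D.h).innerDual q
              (mvfderiv (𝓡 3) ζ q).toLinearMap (mvfderiv (𝓡 3) ζ q).toLinearMap ≤
              (PseudoRiemannianMetric.ofRiemannian D.h).innerDual q
              (mvfderiv (𝓡 3) ζ q).toLinearMap (mvfderiv (𝓡 3) ζ q).toLinearMap := by
            have := mul_le_mul_of_nonneg_right hχsq hI0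
            rwa [one_mul] at this
          have hb : ζ q * ζ q * (PseudoRiemannianMetric.ofRiemannian D.h).innerDual q
              (mvfderiv (𝓡 3) χ q).toLinearMap (mvfderiv (𝓡 3) χ q).toLinearMap ≤
              ζ q * ζ q * (M * A.indicator (fun _ ↦ (1 : ℝ)) q) :=
            mul_le_mul_of_nonneg_left hIq (mul_self_nonneg _)
          linarith
      _ = 2 * ID q + 2 * M * A.indicator (fun x ↦ ζ x ^ 2) q := by
          have hDM : (PseudoRiemannianMetric.ofRiemannian D.h).innerDual = D.metric.innerDual := rfl
          by_cases hq : q ∈ A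
          · simp only [indicator_of_mem hq, hID, hDM]
            ring
          · simp only [indicator_of_notMem hq, hID, hDM]
            ring
  -- integrate
  have hζc' : Continuous ζ := hζ1.continuous
  have hζ2i : Integrable (fun x ↦ ζ x ^ 2) μ :=
    (hζc'.pow 2).integrable_of_hasCompactSupport (hζc.mono fun x hx ↦ by
      rw [mem_support] at hx ⊢
      exact fun h0 ↦ hx (by simp [h0]))
  have hindi : Integrable (A.indicator fun x ↦ ζ x ^ 2) μ := hζ2i.indicator hAm
  have hshell := e.setIntegral_sq_shell_le D hRs hW hdens hζ1 hζc
  have hI0 : 0 ≤ ∫ x, ID x ∂μ := integral_nonneg hID0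
  calc ∫ x, IDf x ∂μ ≤ ∫ x, (2 * ID x + 2 * M * A.indicator (fun x ↦ ζ x ^ 2) x) ∂μ :=
        integral_mono hIDfi ((hIDi.const_mul 2).add (hindi.const_mul (2 * M))) hpt
    _ = 2 * ∫ x, ID x ∂μ + 2 * M * ∫ x in A, ζ x ^ 2 ∂μ := by
        rw [integral_add (hIDi.const_mul 2) (hindi.const_mul (2 * M)), integral_const_mul,
          integral_const_mul, integral_indicator hAm]
    _ ≤ 2 * ∫ x, ID x ∂μ + 2 * M * (224 * s ^ 2 * ∫ x, ID x ∂μ) := by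
        gcongr
    _ = (2 + 2 * M * (224 * s ^ 2)) * ∫ x, ID x ∂μ := by ring

/-! ### Schoen–Yau's Lemma 3.1 -/

/-- **Schoen–Yau 1979, Lemma 3.1 (the Sobolev inequality on an asymptotically flat
`3`-manifold).** Let `X` be a connected `3`-manifold carrying data `(h, k)`, with an
asymptotically flat end `e` on which `h − δ = O₂(r^{−α})` (`α > 0`) and which is the only end of
`X`. Then there is a constant `c₁`, depending only on `X` and `h`, such that for every function
`ζ ∈ C¹_c(X)`,

  `(∫_X |ζ|⁶ dV_h)^{1/3} ≤ c₁ ∫_X h⁻¹(dζ, dζ) dV_h`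

(Schoen–Yau: "For any smooth function `ζ` with compact support on `N` we have
`(∫_N |ζ|⁶)^{1/3} ≤ c₁ ∫_N |∇ζ|²`"). Proof as printed: with a radius `s` beyond which `ds²` is
uniformly equivalent to the Euclidean metric, split `ζ = (1 − χ_s∘coord) ζ + (χ_s∘coord) ζ`; the
first part is estimated by the Euclidean inequality on the end
(`integral_endTruncation_pow_six_le_of_le`), the second by the inequality on the compact core
obtained from the Poincaré inequality and a partition of unity (`exists_core_sobolev`), and the
energy of the second part by `exists_integral_innerDual_cutoff_mul_le`.
[cite: SchoenYauPMT1979, Lemma 3.1 (p. 63)] -/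
theorem sobolev_inequality [ConnectedSpace X] {α : ℝ} (hα : 0 < α)
    (hAF : e.IsMetricAsymptoticallyFlat D α) (hsole : e.IsSoleEnd) :
    ∃ c₁ : ℝ, 0 ≤ c₁ ∧ ∀ ζ : X → ℝ, ContMDiff (𝓡 3) 𝓘(ℝ, ℝ) 1 ζ → HasCompactSupport ζ →
      (∫ x, |ζ x| ^ 6 ∂riemannianMeasure D.h) ^ (1 / 3 : ℝ) ≤
        c₁ * ∫ x, D.metric.innerDual x (mvfderiv (𝓡 3) ζ x).toLinearMap
          (mvfderiv (𝓡 3) ζ x).toLinearMap ∂riemannianMeasure D.h := by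
  classical
  set μ : Measure X := riemannianMeasure D.h with hμ
  haveI : IsFiniteMeasureOnCompacts μ :=
    ⟨fun K hK ↦ riemannianVolume_lt_top_of_isCompact_holds D.h le_rfl hK⟩
  -- the radius `s`
  obtain ⟨s₀, C_E, hRs₀, hC_E, hEnd⟩ := e.integral_endTruncation_pow_six_le_of_le D hα hAF
  obtain ⟨ρE, hρE⟩ := e.exists_radius_abs_gramInvSqrtDet_sub_one_le D hα hAF
    (by norm_num : (0 : ℝ) < 1 / 6)
  obtain ⟨R₃, hR₃⟩ := e.exists_radius_sqrt_det_hCoeff_le D hα hAF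
  set s : ℝ := max (max s₀ ρE) (max R₃ (e.R + 1)) with hsdef
  have hs₀s : s₀ ≤ s := (le_max_left _ _).trans (le_max_left _ _)
  have hρEs : ρE ≤ s := (le_max_right _ _).trans (le_max_left _ _)
  have hR₃s : R₃ ≤ s := (le_max_left _ _).trans (le_max_right _ _)
  have hRs : e.R < s := by
    have : e.R + 1 ≤ s := (le_max_right _ _).trans (le_max_right _ _)
    linarith
  have hs0 : 0 < s := e.R_pos.trans hRs
  have hW : ∀ z : E3, s ≤ ‖z‖ → ∀ k l,
      |(Matrix.of fun i j ↦ hCoeff e D z (EuclideanSpace.single i 1)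
          (EuclideanSpace.single j 1) : Matrix (Fin 3) (Fin 3) ℝ)⁻¹ k l *
        Real.sqrt (Matrix.of fun i j ↦ hCoeff e D z (EuclideanSpace.single i 1)
          (EuclideanSpace.single j 1) : Matrix (Fin 3) (Fin 3) ℝ).det -
        (1 : Matrix (Fin 3) (Fin 3) ℝ) k l| ≤ 1 / 6 := fun z hz ↦ hρE z (hρEs.trans hz)
  have hdens : ∀ z : E3, s ≤ ‖z‖ → Real.sqrt (Matrix.of fun i j ↦
      hCoeff e D z (EuclideanSpace.single i 1) (EuclideanSpace.single j 1)).det ≤ 7 :=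
    fun z hz ↦ hR₃ z (hR₃s.trans hz)
  -- the constants of the core and of the cut-off
  obtain ⟨C_c, hC_ct, hcore⟩ := e.exists_core_sobolev D.h hsole hRs
  obtain ⟨Cχ, hCχ0, hcut⟩ := e.exists_integral_innerDual_cutoff_mul_le D hsole hRs hW hdens
  set Ktot : ℝ := 32 * (C_E + C_c.toReal ^ 6 * Cχ ^ 3) with hKtot
  have hKtot0 : 0 ≤ Ktot := by positivity
  refine ⟨Ktot ^ (1 / 3 : ℝ), by positivity, fun ζ hζ1 hζc ↦ ?_⟩
  -- notation
  set χ : X → ℝ := fun q ↦ cutoff s (e.coord q) with hχ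
  have hχs : ContMDiff (𝓡 3) 𝓘(ℝ, ℝ) ∞ χ := e.contMDiff_cutoff_coord hRs
  have hχ1 : ContMDiff (𝓡 3) 𝓘(ℝ, ℝ) 1 χ := hχs.of_le (by norm_num)
  set ζ₁ : X → ℝ := fun q ↦ (1 - cutoff s (e.coord q)) * ζ q with hζ₁
  set f : X → ℝ := fun q ↦ cutoff s (e.coord q) * ζ q with hf
  set ID : X → ℝ := fun x ↦ D.metric.innerDual x (mvfderiv (𝓡 3) ζ x).toLinearMap
    (mvfderiv (𝓡 3) ζ x).toLinearMap with hID
  have hζc' : Continuous ζ := hζ1.continuous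
  have hf1 : ContMDiff (𝓡 3) 𝓘(ℝ, ℝ) 1 f := hχ1.mul hζ1
  have hfc : Continuous f := hf1.continuous
  have hfcs : HasCompactSupport f := hζc.mul_left
  have hζ₁c : Continuous ζ₁ := (continuous_const.sub hχ1.continuous).mul hζc'
  have hζ₁cs : HasCompactSupport ζ₁ := hζc.mul_left
  have hID0 : ∀ x, 0 ≤ ID x := fun x ↦ innerDual_self_nonneg D.h x _
  have hI0 : 0 ≤ ∫ x, ID x ∂μ := integral_nonneg hID0
  -- (1) the end part
  have hA : ∫ x, ζ₁ x ^ 6 ∂μ ≤ C_E * (∫ x, ID x ∂μ) ^ 3 := hEnd s hs₀s ζ hζ1 hζc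
  -- (2) the core part
  have hf0 : ∀ q ∈ e.far (2 * s), f q = 0 := by
    intro q hq
    obtain ⟨-, hq2⟩ := e.mem_far_iff_coord.1 hq
    simp only [hf, cutoff_eq_zero hs0 hq2.le, zero_mul]
  obtain ⟨hIDfi, hcutζ⟩ := hcut ζ hζ1 hζc
  have hcoreζ := hcore f hf1 hf0
  have hB : ∫ x, f x ^ 6 ∂μ ≤ C_c.toReal ^ 6 * (Cχ * ∫ x, ID x ∂μ) ^ 3 := by
    -- `∫ f⁶ = ‖f‖₆⁶`
    have hmem : MemLp f 6 μ := hfc.memLp_of_hasCompactSupport hfcs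
    have hI6 : ∫ x, f x ^ 6 ∂μ = (eLpNorm f 6 μ).toReal ^ 6 := by
      rw [hmem.eLpNorm_eq_integral_rpow_norm (by norm_num) (by norm_num)]
      have h6 : (6 : ℝ≥0∞).toReal = 6 := by norm_num
      rw [h6]
      have hint6 : ∫ x, ‖f x‖ ^ (6 : ℝ) ∂μ = ∫ x, f x ^ 6 ∂μ := by
        refine integral_congr_ae (Eventually.of_forall fun x ↦ ?_)
        simp only [Real.norm_eq_abs]
        rw [show (6 : ℝ) = ((6 : ℕ) : ℝ) by norm_num, Real.rpow_natCast, Even.pow_abs (by decide)]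
      rw [hint6]
      have hI0' : 0 ≤ ∫ x, f x ^ 6 ∂μ := integral_nonneg fun _ ↦ by positivity
      rw [ENNReal.toReal_ofReal (Real.rpow_nonneg hI0' _)]
      rw [show ((6 : ℝ)⁻¹) = ((6 : ℕ) : ℝ)⁻¹ by norm_num, Real.rpow_inv_natCast_pow hI0' (by norm_num)]
    -- the energy of `f` in `ℝ≥0∞`
    have hIDf0 : ∀ x, 0 ≤ D.metric.innerDual x (mvfderiv (𝓡 3) f x).toLinearMap
        (mvfderiv (𝓡 3) f x).toLinearMap := fun x ↦ innerDual_self_nonneg D.h x _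
    have hlin : ∫⁻ p, ENNReal.ofReal ((PseudoRiemannianMetric.ofRiemannian D.h).innerDual p
        (mvfderiv (𝓡 3) f p).toLinearMap (mvfderiv (𝓡 3) f p).toLinearMap) ∂μ ≤
        ENNReal.ofReal (Cχ * ∫ x, ID x ∂μ) := by
      have h := ofReal_integral_eq_lintegral_ofReal hIDfi (Eventually.of_forall hIDf0)
      change ∫⁻ p, ENNReal.ofReal (D.metric.innerDual p
        (mvfderiv (𝓡 3) (fun q ↦ cutoff s (e.coord q) * ζ q) p).toLinearMap
        (mvfderiv (𝓡 3) (fun q ↦ cutoff s (e.coord q) * ζ q) p).toLinearMap) ∂μ ≤ _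
      rw [← h]
      exact ENNReal.ofReal_le_ofReal hcutζ
    have h1 : eLpNorm f 6 μ ≤ C_c * (ENNReal.ofReal (Cχ * ∫ x, ID x ∂μ)) ^ (1 / 2 : ℝ) :=
      hcoreζ.trans (mul_le_mul_right (ENNReal.rpow_le_rpow hlin (by norm_num)) _)
    have hfin : C_c * (ENNReal.ofReal (Cχ * ∫ x, ID x ∂μ)) ^ (1 / 2 : ℝ) ≠ ⊤ :=
      ENNReal.mul_ne_top hC_ct (ENNReal.rpow_ne_top_of_nonneg (by norm_num) ENNReal.ofReal_ne_top)
    have h2 : (eLpNorm f 6 μ).toReal ≤ C_c.toReal * Real.sqrt (Cχ * ∫ x, ID x ∂μ) := by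
      have h := ENNReal.toReal_mono hfin h1
      rw [ENNReal.toReal_mul, ← ENNReal.toReal_rpow, ENNReal.toReal_ofReal (by positivity),
        ← Real.sqrt_eq_rpow] at h
      exact h
    have hCI0 : 0 ≤ Cχ * ∫ x, ID x ∂μ := by positivity
    rw [hI6]
    calc (eLpNorm f 6 μ).toReal ^ 6 ≤ (C_c.toReal * Real.sqrt (Cχ * ∫ x, ID x ∂μ)) ^ 6 :=
          pow_le_pow_left₀ ENNReal.toReal_nonneg h2 6
      _ = C_c.toReal ^ 6 * (Cχ * ∫ x, ID x ∂μ) ^ 3 := by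
          rw [mul_pow, show (6 : ℕ) = 2 * 3 by norm_num, pow_mul (Real.sqrt _), Real.sq_sqrt hCI0]
  -- (3) `∫ |ζ|⁶ ≤ 32 (∫ ζ₁⁶ + ∫ f⁶)`
  have hsplit : ∀ x, ζ x = ζ₁ x + f x := fun x ↦ by simp only [hζ₁, hf]; ring
  have hζ₁6i : Integrable (fun x ↦ ζ₁ x ^ 6) μ :=
    (hζ₁c.pow 6).integrable_of_hasCompactSupport (hζ₁cs.mono fun x hx ↦ by
      rw [mem_support] at hx ⊢
      exact fun h0 ↦ hx (by simp [h0]))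
  have hf6i : Integrable (fun x ↦ f x ^ 6) μ :=
    (hfc.pow 6).integrable_of_hasCompactSupport (hfcs.mono fun x hx ↦ by
      rw [mem_support] at hx ⊢
      exact fun h0 ↦ hx (by simp [h0]))
  have hζ6i : Integrable (fun x ↦ |ζ x| ^ 6) μ :=
    ((continuous_abs.comp hζc').pow 6).integrable_of_hasCompactSupport (hζc.mono fun x hx ↦ by
      rw [mem_support] at hx ⊢
      exact fun h0 ↦ hx (by simp [h0]))
  have hC : ∫ x, |ζ x| ^ 6 ∂μ ≤ 32 * (∫ x, ζ₁ x ^ 6 ∂μ + ∫ x, f x ^ 6 ∂μ) := by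
    calc ∫ x, |ζ x| ^ 6 ∂μ ≤ ∫ x, 32 * (ζ₁ x ^ 6 + f x ^ 6) ∂μ := by
          refine integral_mono hζ6i ((hζ₁6i.add hf6i).const_mul 32) fun x ↦ ?_
          show |ζ x| ^ 6 ≤ 32 * (ζ₁ x ^ 6 + f x ^ 6)
          rw [Even.pow_abs (by decide), hsplit x]
          exact add_pow_six_le _ _
      _ = 32 * (∫ x, ζ₁ x ^ 6 ∂μ + ∫ x, f x ^ 6 ∂μ) := by
          rw [integral_const_mul, integral_add hζ₁6i hf6i]
  -- (4) assemble
  have hD : ∫ x, |ζ x| ^ 6 ∂μ ≤ Ktot * (∫ x, ID x ∂μ) ^ 3 := by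
    calc ∫ x, |ζ x| ^ 6 ∂μ ≤ 32 * (∫ x, ζ₁ x ^ 6 ∂μ + ∫ x, f x ^ 6 ∂μ) := hC
      _ ≤ 32 * (C_E * (∫ x, ID x ∂μ) ^ 3 + C_c.toReal ^ 6 * (Cχ * ∫ x, ID x ∂μ) ^ 3) := by
          gcongr
      _ = Ktot * (∫ x, ID x ∂μ) ^ 3 := by
          simp only [hKtot]
          ring
  have hL0 : 0 ≤ ∫ x, |ζ x| ^ 6 ∂μ := integral_nonneg fun _ ↦ by positivity
  calc (∫ x, |ζ x| ^ 6 ∂μ) ^ (1 / 3 : ℝ) ≤ (Ktot * (∫ x, ID x ∂μ) ^ 3) ^ (1 / 3 : ℝ) :=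
        Real.rpow_le_rpow hL0 hD (by norm_num)
    _ = Ktot ^ (1 / 3 : ℝ) * ∫ x, ID x ∂μ := by
        rw [Real.mul_rpow hKtot0 (by positivity), one_div,
          show ((3 : ℝ)⁻¹) = ((3 : ℕ) : ℝ)⁻¹ by norm_num, Real.pow_rpow_inv_natCast hI0 (by norm_num)]

end AFEnd

end Literature.Geometry.Lorentzian

end
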